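import Literature.Analysis.FluidPDE.NSCoriolis
import Literature.Analysis.FluidPDE.ClassicalSolutionTorusProofs
import HarnessLib

/-!
# Babin–Mahalov–Nicolaenko's theorem: reduction of the periodic statement on `ℝ³` to the torus

Analysis/FluidPDE proof file (theorems only; no definitions, no named facts), sibling of
`NSCoriolis.lean`, supporting the named fact
`Literature.Analysis.FluidPDE.bmn1999_rotating_ns_global_regularity` (Babin–Mahalov–Nicolaenko,
Indiana Univ. Math. J. 48 (1999), Thm. 1.1 = Thm. 5.3).

The fact is rendered, as the periodic Clay problem is (`NSWave0.lean`), for `ℤ³`-periodic fields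
on `ℝ³`: smooth periodic divergence-free zero-mean data `U₀` with `∫_{[0,1)³} |∇U₀|² ≤ M²`, and a
periodic classical solution `(U, p)` of the rotating system on `ℝ³ × [0, ∞)` with
`∫_{[0,1)³} |∇U(t)|² ≤ M'²`. BMN work on the torus ("boundary conditions periodic … we use Fourier
series", p. 1133–1134), where every later step of the proof lives (Fourier series, Leray
projector, Stokes operator, `H^α` norms (1.4)). This file fixes the translation once:

* `setOf_forall_mem_Ico_eq_unitCube` — the fact's cell `{x | ∀ i, xᵢ ∈ [0,1)}` is the tree's
  fundamental domain `Torus.unitCube`;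
* `frobeniusNormSq_fderiv_lift`, `setIntegral_unitCube_frobeniusNormSq_fderiv_lift` — for a `C¹`
  field `v` on `𝕋^d`, `|∇(v ∘ proj)|²(y) = ∑ᵢ ‖∂ᵢv (proj y)‖²` and
  `∫_{[0,1)^d} |∇(v ∘ proj)|² = ‖∇v‖²_{L²(𝕋^d)}` (`Torus.gradNormSq`), i.e. the fact's `H¹`
  quantity is BMN's `‖U‖₁²` ((1.4) with `α = 1`, unit periods);
* `setIntegral_unitCube_eq_integral_descend` — the cell average of a periodic field is the torus
  mean of its descent (BMN p. 1134: zero averages);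
* `bmn1999_rotating_ns_global_regularity_of_torus` — **reduction to the torus**: the fact
  follows from its natural torus form — for every `ν > 0`, `M` there are `Ω₁`, `M'` such that for
  `Ω ≥ Ω₁` every smooth divergence-free mean-zero `u₀ : 𝕋³ → ℝ³` with `‖∇u₀‖₂² ≤ M²` launches a
  global classical solution `(u, p)` on `𝕋³ × [0, ∞)` of the Navier–Stokes system forced by
  `−Ω e₃ × u` (the rotating system read on the torus, cf. `NSCoriolis`'s forcing bridge) with
  `‖∇u(t)‖₂² ≤ M'²` — by descending the datum (`Torus.descend`, `Torus.lift_descend_holds`),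
  lifting the solution (`IsClassicalNSSolutionOn.of_torus_holds`, `Torus.isLatticePeriodic_lift`)
  and the two dictionary entries above. Any torus-side proof of BMN's Thm. 1.1 (Galerkin /
  Fourier, as the tree's torus Navier–Stokes theory is organised) discharges the fact through
  this theorem.

## Mathlib / tree search

Tree (reused): `Torus.unitCube`, `Torus.lift/descend/proj`, `Torus.lift_descend_holds`,
`Torus.integral_eq_integral_lift_holds`, `Torus.isLatticePeriodic_lift` (`FlatTorus(Proofs)`),
`Torus.partialDeriv_eq_fderiv_apply`, `Torus.fderiv_lift` (`TorusCalculus`), `Torus.gradNormSq`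
(`TorusFluidGlue`), `frobeniusNormSq_eq_sum` (`VectorCalculus`), `isDivFree_lift_iff`,
`IsClassicalNSSolutionOn.of_torus_holds` (`ClassicalSolutionTorusProofs`),
`IsClassicalNSCoriolisSolutionOn` (`NSCoriolis`). Mathlib: `EuclideanSpace.basisFun`,
`setIntegral_congr_fun`.

## References

* A. Babin, A. Mahalov, B. Nicolaenko, *Global regularity of 3D rotating Navier–Stokes equations
  for resonant domains*, Indiana Univ. Math. J. 48 (1999) 1133–1176, §1 (1.1)–(1.4), Thm. 1.1.
  [BabinMahalovNicolaenko1999]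
-/

noncomputable section

open MeasureTheory Set Function
open scoped ContDiff InnerProductSpace RealInnerProductSpace

namespace Literature.Analysis.FluidPDE

/-! ### Dictionary between `ℤ^d`-periodic fields on `ℝ^d` and fields on `𝕋^d` -/

section Dictionary

variable {d : Type*} [Fintype d] [DecidableEq d]

omit [Fintype d] [DecidableEq d] in
/-- The fact's period cell `{x | ∀ i, xᵢ ∈ [0, 1)}` is the tree's fundamental domain
`Torus.unitCube d` (definitionally). [folklore] -/
theorem setOf_forall_mem_Ico_eq_unitCube :
    {x : EuclideanSpace ℝ d | ∀ i, x i ∈ Ico (0 : ℝ) 1} = FunctionSpaces.Torus.unitCube d := rfl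

/-- **Pointwise dissipation density of a periodic field**: for a `C¹` field `v` on `𝕋^d`, the
squared Frobenius norm of the derivative of its lift at `y` is `∑ᵢ ‖∂ᵢ v (proj y)‖²` (basis
independence of the Frobenius norm, `frobeniusNormSq_eq_sum`, in the standard basis; the lift's
derivative is the torus derivative, `Torus.fderiv_lift`). [folklore] -/
theorem frobeniusNormSq_fderiv_lift {v : UnitAddTorus d → EuclideanSpace ℝ d}
    (hv : FunctionSpaces.Torus.IsContDiff 1 v) (y : EuclideanSpace ℝ d) :
    frobeniusNormSq (fderiv ℝ (FunctionSpaces.Torus.lift v) y) =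
      ∑ i, ‖FunctionSpaces.Torus.partialDeriv i v (FunctionSpaces.Torus.proj y)‖ ^ 2 := by
  rw [frobeniusNormSq_eq_sum (EuclideanSpace.basisFun d ℝ), FunctionSpaces.Torus.fderiv_lift]
  refine Finset.sum_congr rfl fun i _ => ?_
  rw [FunctionSpaces.Torus.partialDeriv_eq_fderiv_apply hv, EuclideanSpace.basisFun_apply]

/-- **The fact's `H¹` quantity is the torus gradient norm**: for a `C¹` field `v` on `𝕋^d`,
`∫_{[0,1)^d} |∇(v ∘ proj)|² = ‖∇v‖²_{L²(𝕋^d)}` (`Torus.gradNormSq v = ∫_{𝕋^d} ∑ᵢ ‖∂ᵢv‖²`; BMN 1999,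
(1.4) with `α = 1`: `‖U‖₁² = ∑ₙ |ň|²|Uₙ|² = ∫ |∇U|²` for unit periods), by unfolding the torus
integral over the fundamental domain (`Torus.integral_eq_integral_lift_holds`).
[cite: BabinMahalovNicolaenko1999, eq. (1.4)] -/
theorem setIntegral_unitCube_frobeniusNormSq_fderiv_lift {v : UnitAddTorus d → EuclideanSpace ℝ d}
    (hv : FunctionSpaces.Torus.IsContDiff 1 v) :
    ∫ y in FunctionSpaces.Torus.unitCube d,
        frobeniusNormSq (fderiv ℝ (FunctionSpaces.Torus.lift v) y) =
      FunctionSpaces.Torus.gradNormSq v := by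
  rw [FunctionSpaces.Torus.gradNormSq, FunctionSpaces.Torus.integral_eq_integral_lift_holds]
  refine setIntegral_congr_fun FunctionSpaces.Torus.measurableSet_unitCube fun y _ => ?_
  rw [frobeniusNormSq_fderiv_lift hv, FunctionSpaces.Torus.lift_apply]

/-- **Cell averages are torus means**: for a `ℤ^d`-periodic field `U` on `ℝ^d`,
`∫_{[0,1)^d} U = ∫_{𝕋^d} (descend U)` (`Torus.integral_eq_integral_lift_holds` and
`lift (descend U) = U`). [folklore] -/
theorem setIntegral_unitCube_eq_integral_descend {F : Type*} [NormedAddCommGroup F]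
    [NormedSpace ℝ F] (U : EuclideanSpace ℝ d → F) (hU : FunctionSpaces.Torus.IsLatticePeriodic U) :
    ∫ y in FunctionSpaces.Torus.unitCube d, U y = ∫ x, FunctionSpaces.Torus.descend U hU x := by
  rw [FunctionSpaces.Torus.integral_eq_integral_lift_holds,
    FunctionSpaces.Torus.lift_descend_holds]

end Dictionary

/-! ### Reduction of the fact to the torus -/

/-- **Babin–Mahalov–Nicolaenko's theorem, periodic-on-`ℝ³` form from the torus form.** Suppose
the torus statement of BMN 1999, Thm. 1.1 (unit periods, `F = 0`, `α = 1`, smooth data): for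
every `ν > 0` and `M` there are `Ω₁`, `M'` such that for every `Ω ≥ Ω₁` and every smooth,
divergence-free, mean-zero `u₀ : 𝕋³ → ℝ³` with `‖∇u₀‖²_{L²(𝕋³)} ≤ M²` there is a classical solution
`(u, p)` on `𝕋³ × [0, ∞)` of the Navier–Stokes system with viscosity `ν` and force `−Ω e₃ × u`
(the rotating system (1.1) on the torus) with `u(0) = u₀` and `‖∇u(t)‖²_{L²(𝕋³)} ≤ M'²` for all
`t ≥ 0`. Then `bmn1999_rotating_ns_global_regularity` holds: descend the periodic datum to the
torus (smoothness, incompressibility, zero mean and the `H¹` bound transfer by `Torus.IsSmooth`'s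
definition, `isDivFree_lift_iff`, `setIntegral_unitCube_eq_integral_descend`,
`setIntegral_unitCube_frobeniusNormSq_fderiv_lift`), solve there, and lift the solution
(`IsClassicalNSSolutionOn.of_torus_holds`, the Coriolis force moving back to the left-hand
side; lifts are periodic, `Torus.isLatticePeriodic_lift`). [cite: BabinMahalovNicolaenko1999, Thm. 1.1 with (1.1), (1.4)] -/
theorem bmn1999_rotating_ns_global_regularity_of_torus
    (H : ∀ ν : ℝ, 0 < ν → ∀ M : ℝ, ∃ Ω₁ M' : ℝ, ∀ Ω : ℝ, Ω₁ ≤ Ω →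
      ∀ u₀ : UnitAddTorus (Fin 3) → EuclideanSpace ℝ (Fin 3),
        FunctionSpaces.Torus.IsSmooth u₀ → FunctionSpaces.Torus.IsDivFree u₀ →
        FunctionSpaces.Torus.HasZeroMean u₀ → FunctionSpaces.Torus.gradNormSq u₀ ≤ M ^ 2 →
        ∃ (u : ℝ → UnitAddTorus (Fin 3) → EuclideanSpace ℝ (Fin 3))
          (p : ℝ → UnitAddTorus (Fin 3) → ℝ),
          FunctionSpaces.Torus.IsClassicalNSSolutionOn (Ici 0) ν
              (fun t x => -coriolisForce Ω (u t x)) u p ∧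
            u 0 = u₀ ∧ ∀ t : ℝ, 0 ≤ t → FunctionSpaces.Torus.gradNormSq (u t) ≤ M' ^ 2) :
    bmn1999_rotating_ns_global_regularity := by
  intro ν hν M
  obtain ⟨Ω₁, M', hH⟩ := H ν hν M
  refine ⟨Ω₁, M', fun Ω hΩ U₀ hC hper hdiv hmean hgrad => ?_⟩
  -- descend the datum to the torus
  have hper' : FunctionSpaces.Torus.IsLatticePeriodic U₀ := hper
  have hU : FunctionSpaces.Torus.lift (FunctionSpaces.Torus.descend U₀ hper') = U₀ :=
    FunctionSpaces.Torus.lift_descend_holds U₀ hper'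
  have hsm : FunctionSpaces.Torus.IsSmooth (FunctionSpaces.Torus.descend U₀ hper') := by
    show ContDiff ℝ ∞ (FunctionSpaces.Torus.lift (FunctionSpaces.Torus.descend U₀ hper'))
    rw [hU]
    exact hC
  have hc1 : FunctionSpaces.Torus.IsContDiff 1 (FunctionSpaces.Torus.descend U₀ hper') :=
    hsm.isContDiff (by simp)
  have hdiv' : FunctionSpaces.Torus.IsDivFree (FunctionSpaces.Torus.descend U₀ hper') :=
    (isDivFree_lift_iff hc1).1 (by rw [hU]; exact hdiv)
  have hmean' : FunctionSpaces.Torus.HasZeroMean (FunctionSpaces.Torus.descend U₀ hper') := by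
    show ∫ x, FunctionSpaces.Torus.descend U₀ hper' x = 0
    rw [← setIntegral_unitCube_eq_integral_descend U₀ hper']
    exact hmean
  have hgrad' : FunctionSpaces.Torus.gradNormSq (FunctionSpaces.Torus.descend U₀ hper') ≤ M ^ 2 := by
    rw [← setIntegral_unitCube_frobeniusNormSq_fderiv_lift hc1, hU]
    exact hgrad
  -- solve on the torus and lift
  obtain ⟨u, p, hsol, h0, hbd⟩ := hH Ω hΩ _ hsm hdiv' hmean' hgrad'
  have h1 := IsClassicalNSSolutionOn.of_torus_holds hsol
  refine ⟨fun t => FunctionSpaces.Torus.lift (u t), fun t => FunctionSpaces.Torus.lift (p t),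
    ⟨h1.smooth_velocity, h1.smooth_pressure, fun t ht y => ?_, h1.divFree⟩, ?_, ?_, ?_⟩
  · -- the Coriolis force back on the left-hand side
    have hm := h1.momentum t ht y
    simp only [FunctionSpaces.Torus.lift_apply, Pi.zero_apply, add_zero] at hm ⊢
    rw [hm]
    abel
  · -- initial datum
    show FunctionSpaces.Torus.lift (u 0) = U₀
    rw [h0, hU]
  · -- periodicity of the lifted velocity and pressure
    exact fun t _ j x => ⟨FunctionSpaces.Torus.isLatticePeriodic_lift (u t) j x,
      FunctionSpaces.Torus.isLatticePeriodic_lift (p t) j x⟩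
  · -- the `H¹` bound
    intro t ht
    have hct : FunctionSpaces.Torus.IsContDiff 1 (u t) :=
      (hsol.smooth_velocity.isSmooth_slice ht).isContDiff (by simp)
    show ∫ x in FunctionSpaces.Torus.unitCube (Fin 3),
        frobeniusNormSq (fderiv ℝ (FunctionSpaces.Torus.lift (u t)) x) ≤ M' ^ 2
    rw [setIntegral_unitCube_frobeniusNormSq_fderiv_lift hct]
    exact hbd t ht

end Literature.Analysis.FluidPDE

end
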